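import Literature.NumberTheory.Automorphic.CuspFormCornerDecay
import Literature.NumberTheory.Automorphic.JPSSProjectedGlobalIntegral
import Literature.NumberTheory.Automorphic.AdelicVectorHeightCompact
import Literature.NumberTheory.Automorphic.AdelicVectorHeightBound
import Literature.NumberTheory.Automorphic.AdelicHeightGLSiegel
import Literature.NumberTheory.Automorphic.AdelicHeightGLContinuity

/-!
# Two adelic height inequalities on `GL_n(𝔸_K)` (decay road, stub `stub_decay_height_lemmas`)

Elementary height estimates used by the cusp lemma of the decay road for the boundary
Jacquet–Shalika argument (`Summit.Langlands.Langlands.Theses.IrreducibilityBySelfDuality.PairLBoundaryJS`,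
line Sketch, wave 4): for the global height `vecHeight K x = ∏_{w ∣ ∞} ‖x‖_w^{mult w} ∏ᶠ_v h_v(x)`
of an adelic row vector `x ∈ 𝔸_Kⁿ` (`AdelicVectorHeight`),

* `one_le_vecHeight_of_apply_eq_algebraMap` — **lower bound**: if `x` has finite height data and
  one coordinate `x_{j₀} = c ∈ Kˣ` is a non-zero *principal* adele, then `1 ≤ h(x)` (product
  formula `∏_v |c|_v = 1` and `|x_{j₀}|_v ≤ h_v(x)` place by place; Garrett (2018), §2.2, proof of
  Cor. 2.2.6, the case of a fully rational vector being `one_le_vecHeight_principalVec`);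
* `exists_vecHeight_row_le` — **upper bound**: for `ω` in a compact subset `Ω` of the Borel
  subgroup `B(𝔸_K)`, `a ∈ (ℝ_{>0})ⁿ` and `k` in the maximal compact subgroup
  `K = K_∞ · GL_n(𝒪̂_K)`, the `i`-th row of `ω · diag(z(a)) · k` has height `≤ C_Ω · A^{[K:ℚ]}`
  as soon as `a_j ≤ A` for all `j ≥ i`: `k` preserves heights
  (`vecHeight_vecMul_of_mem_standardMaximalCompactGL`), row `i` of `ω · diag(z(a))` is
  `(0, …, 0, ω_{ii} z(a_i), …, ω_{in} z(a_n))` (`ω` is upper triangular), the ideles `z(a_j)` are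
  `1` at the finite places and of absolute value `a_j ≤ A` at the infinite ones, and the entries of
  `ω` are dominated by the local factors `H_∞(ω)`, `H_v(ω)` of the Borel–Jacquet height
  `‖ω‖ = H_∞(ω) ∏ᶠ_v H_v(ω)` (`AdelicGLnGlue`), which are bounded on the compact set `Ω`
  (`GLn.continuous_archHeight`, `GLn.continuous_finprod_localHeight`);
* `stub_decay_height_lemmas` — the registered conjunction of the two.

## References

* P. Garrett, *Modern Analysis of Automorphic Forms by Example* (2018), §2.2 (PDF pp. 81–84)
  [Garrett2018].
* A. Borel, H. Jacquet, *Automorphic forms and automorphic representations*, Proc. Sympos. Pure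
  Math. 33 (1979), Part 1, §1.2 [BorelJacquetCorvallis1979].
* R. Godement, *Domaines fondamentaux des groupes arithmétiques*, Sém. Bourbaki 257 (1962/63),
  §1.1.
-/

noncomputable section

-- `Summit.Langlands.Langlands.…` (summit = sub-problem name, D-0017 layout) trips `dupNamespace`
set_option linter.dupNamespace false

open scoped MatrixGroups Topology Pointwise ENNReal NNReal ComplexConjugate
open scoped Classical Matrix.Norms.Operator
open NumberField IsDedekindDomain MeasureTheory Measure Matrix Set Filter
open Literature.NumberTheory.Automorphic AdelicGroupData

-- the house local instances, exactly as in `RankinSelbergUnfoldingIdentity`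
attribute [local instance] adelicBorel borelSpace_adelic locallyCompactSpace_adelic secondCountableTopology_gl_adelic
  glAdeleBorel borelSpace_glAdele borelSpace_ideleGroup secondCountableTopology_ideleGroup

namespace Summit.Langlands.Langlands.Theorems.GapDecayHeights

variable {K : Type} [Field K] [NumberField K] {n : ℕ}

/-! ### (a) The lower bound: a non-zero principal coordinate forces height `≥ 1` -/

/-- **An adelic vector with a non-zero principal coordinate has height at least `1`.** If
`x ∈ 𝔸_Kⁿ` has finite height data and `x_{j₀} = c` for some `c ∈ Kˣ` (diagonally embedded), then
`1 = ∏_v |c|_v ≤ h(x)`: the product formula for `c` (`ideleNorm_principal`) and the coordinate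
bounds `|x_{j₀}|_w ≤ ‖x‖_w`, `|x_{j₀}|_v ≤ h_v(x)` (Garrett (2018), §2.2, proof of Cor. 2.2.6:
"`h(c m₁ d) ≥ |c m₁| = |m₁|` by the product rule, since `c ∈ kˣ`"; the fully rational case is
`one_le_vecHeight_principalVec`). [cite: Garrett2018, §2.2 (PDF p. 84)] -/
theorem one_le_vecHeight_of_apply_eq_algebraMap (x : Fin n → AdeleRing (𝓞 K) K) (j₀ : Fin n)
    {c : K} (hc : c ≠ 0) (hx : x j₀ = algebraMap K (AdeleRing (𝓞 K) K) c)
    (hfin : IsHeightFinite K x) : 1 ≤ vecHeight K x := by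
  -- adapted from `one_le_vecHeight_principalVec` (AdelicVectorHeight)
  set u : (AdeleRing (𝓞 K) K)ˣ :=
    Units.map (algebraMap K (AdeleRing (𝓞 K) K) : K →* _) (Units.mk0 c hc) with hu
  have hu1 : IdeleClassGroup.ideleNorm K u = 1 := ideleNorm_principal ⟨Units.mk0 c hc, rfl⟩
  have hucoe : (u : AdeleRing (𝓞 K) K) = x j₀ := by rw [hx]; rfl
  rw [← hu1, ideleNorm_apply, vecHeight, hucoe]
  refine mul_le_mul' (Finset.prod_le_prod' fun w _ => ?_) ?_
  · exact pow_le_pow_left' (nnnorm_fst_apply_le_vecArchNorm w _ j₀) _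
  · refine finprod_le_finprod' ?_ hfin fun v => ?_
    · rw [← hucoe]; exact hasFiniteMulSupport_nnnorm K u
    · exact nnnorm_snd_apply_le_vecFinHeight v _ j₀

/-! ### (b) The upper bound: rows of `ω · diag(z(a)) · k` -/

/-- The entries of `g ∈ GL_n(𝔸_K)` at an infinite place `w` are dominated by the archimedean
height `H_∞(g)` (the `w`-component of `(g_∞)_{ij} ∈ ℝ^{r₁} × ℂ^{r₂}` is the image of `(g_{ij})_w`
under the isometric embedding `K_w → ℝ` resp. `ℂ`, and `ℝ^{r₁} × ℂ^{r₂}` carries the sup norm).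
Borel–Jacquet (1979), §1.2. [cite: BorelJacquetCorvallis1979, §1.2] -/
theorem nnnorm_fst_apply_le_archHeight (g : GL (Fin n) (AdeleRing (𝓞 K) K)) (i j : Fin n)
    (w : InfinitePlace K) :
    ‖(((g : Matrix (Fin n) (Fin n) (AdeleRing (𝓞 K) K)) i j).1) w‖₊ ≤ GLn.archHeight n K g := by
  refine le_trans ?_ (nnnorm_apply_le_sup (GLn.toMixed n K g) i j)
  rw [← NNReal.coe_le_coe, coe_nnnorm, coe_nnnorm]
  rcases w.isReal_or_isComplex with hw | hw
  · have h1 : ((GLn.toMixed n K g : Matrix (Fin n) (Fin n) (mixedEmbedding.mixedSpace K)) i j).1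
        ⟨w, hw⟩ = InfinitePlace.Completion.extensionEmbeddingOfIsReal hw
          ((((g : Matrix (Fin n) (Fin n) (AdeleRing (𝓞 K) K)) i j).1) w) := rfl
    rw [← (AddMonoidHomClass.isometry_iff_norm _).1
      (InfinitePlace.Completion.isometry_extensionEmbeddingOfIsReal hw), ← h1]
    exact (norm_le_pi_norm _ _).trans (norm_fst_le _)
  · have h1 : ((GLn.toMixed n K g : Matrix (Fin n) (Fin n) (mixedEmbedding.mixedSpace K)) i j).2
        ⟨w, hw⟩ = InfinitePlace.Completion.extensionEmbedding w
          ((((g : Matrix (Fin n) (Fin n) (AdeleRing (𝓞 K) K)) i j).1) w) := rfl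
    rw [← (AddMonoidHomClass.isometry_iff_norm _).1
      (InfinitePlace.Completion.isometry_extensionEmbedding w), ← h1]
    exact (norm_le_pi_norm _ _).trans (norm_snd_le _)

/-- The entries of `g ∈ GL_n(𝔸_K)` at a finite place `v` are dominated by the local height
`H_v(g) = max_{ij} (|g_{ij}|_v ⊔ |(g⁻¹)_{ij}|_v)`. Borel–Jacquet (1979), §1.2.
[cite: BorelJacquetCorvallis1979, §1.2] -/
theorem nnnorm_snd_apply_le_localHeight (g : GL (Fin n) (AdeleRing (𝓞 K) K)) (i j : Fin n)
    (v : HeightOneSpectrum (𝓞 K)) :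
    ‖(((g : Matrix (Fin n) (Fin n) (AdeleRing (𝓞 K) K)) i j).2) v‖₊ ≤ GLn.localHeight n K v g := by
  have h := nnnorm_apply_le_sup (Matrix.GeneralLinearGroup.map (AdelicGroupData.adeleEval K v) g) i j
  rw [Matrix.GeneralLinearGroup.map_apply, AdelicGroupData.adeleEval_apply] at h
  exact h

/-- Rows of a product of matrices: `(P Q)_i = P_i Q` (row vector times `Q`). [folklore] -/
theorem mul_apply_eq_vecMul {m : ℕ} {R : Type*} [CommRing R] (P Q : Matrix (Fin m) (Fin m) R)
    (i : Fin m) : (P * Q) i = P i ᵥ* Q := rfl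

/-- **Rows of `ω · diag(z(a)) · k` have height `≪_Ω A^{[K:ℚ]}`.** For a compact subset `Ω` of the
Borel subgroup `B(𝔸_K)` there is `C` such that for `ω ∈ Ω`, `a ∈ (ℝ_{>0})ⁿ`,
`k ∈ K = K_∞ · GL_n(𝒪̂_K)`, a row index `i` and `A ≥ a_j` for all `j ≥ i`, the `i`-th row of
`ω · diag(z(a₁), …, z(aₙ)) · k` has height `≤ C · A^{[K:ℚ]}`: `k` preserves heights, row `i` of
`ω · diag(z(a))` is `(ω_{ij} z(a_j))_{j ≥ i}` (`ω` upper triangular), `|z(a_j)|_v = 1` at finite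
`v` and `= a_j ≤ A` at infinite `w`, and `|ω_{ij}|_v ≤ H_v(ω)`, `|ω_{ij}|_w ≤ H_∞(ω)` with
`H_∞`, `∏ᶠ_v H_v` bounded on `Ω`; hence
`h ≤ (√n · H_∞(ω) · A)^{∑_w mult w} ∏ᶠ_v H_v(ω) ≤ C A^{[K:ℚ]}` (`∑_w mult w = [K:ℚ]`). This is the
height computation on Siegel sets of Godement, Sém. Bourbaki 257, §1.1 (vi) / Garrett (2018),
Thm. 2.2.2 (`h(x g) ≪_C h(x)` for `g` in a compact set), in the row-by-row form used by the cusp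
lemma. [cite: Garrett2018, Thm. 2.2.2 (PDF p. 82)] -/
theorem exists_vecHeight_row_le {Ω : Set (GL (Fin n) (AdeleRing (𝓞 K) K))} (hΩ : IsCompact Ω)
    (hΩB : Ω ⊆ (standardParabolicGL (AdeleRing (𝓞 K) K) (id : Fin n → Fin n) :
      Set (GL (Fin n) (AdeleRing (𝓞 K) K)))) :
    ∃ C : ℝ≥0, ∀ ω ∈ Ω, ∀ (a : Fin n → ℝ≥0ˣ), ∀ k ∈ standardMaximalCompactGL n K,
      ∀ (i : Fin n) (A : ℝ≥0), (∀ j : Fin n, i ≤ j → (a j : ℝ≥0) ≤ A) →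
        vecHeight K (((ω * posRealDiagonal n K a * k : GL (Fin n) (AdeleRing (𝓞 K) K)) :
          Matrix (Fin n) (Fin n) (AdeleRing (𝓞 K) K)) i) ≤ C * A ^ Module.finrank ℚ K := by
  rcases Nat.eq_zero_or_pos n with hn | hn
  · subst hn
    exact ⟨0, fun ω _ a k _ i => (Nat.not_lt_zero _ i.2).elim⟩
  haveI : NeZero n := ⟨hn.ne'⟩
  -- `H_∞` and `∏ᶠ_v H_v` are bounded on the compact set `Ω`
  obtain ⟨B₁, hB₁⟩ :=
    hΩ.bddAbove_image (GLn.continuous_archHeight (n := n) (K := K)).continuousOn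
  obtain ⟨B₂, hB₂⟩ :=
    hΩ.bddAbove_image (GLn.continuous_finprod_localHeight (n := n) (K := K)).continuousOn
  refine ⟨(NNReal.sqrt n * B₁) ^ Module.finrank ℚ K * B₂.toNNReal, ?_⟩
  intro ω hω a k hk i A hA
  have hB₁ω : GLn.archHeight n K ω ≤ B₁ := hB₁ (Set.mem_image_of_mem _ hω)
  have hB₂ω : ∏ᶠ v, GLn.localHeight n K v ω ≤ B₂.toNNReal := by
    refine NNReal.le_toNNReal_of_coe_le ?_
    have hcoe : (((∏ᶠ v, GLn.localHeight n K v ω : ℝ≥0)) : ℝ) =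
        ∏ᶠ v, (GLn.localHeight n K v ω : ℝ) :=
      NNReal.toRealHom.map_finprod_of_injective NNReal.coe_injective _
    rw [hcoe]
    exact hB₂ (Set.mem_image_of_mem _ hω)
  -- the row is `(row i of ω D) k`, and `k` preserves heights
  rw [Units.val_mul, mul_apply_eq_vecMul, vecHeight_vecMul_of_mem_standardMaximalCompactGL hk]
  -- entries of `ω D`
  have hMij : ∀ j, ((ω * posRealDiagonal n K a : GL (Fin n) (AdeleRing (𝓞 K) K)) :
      Matrix (Fin n) (Fin n) (AdeleRing (𝓞 K) K)) i j =
        (ω : Matrix (Fin n) (Fin n) (AdeleRing (𝓞 K) K)) i j *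
          ((posRealIdele K (a j) : (AdeleRing (𝓞 K) K)ˣ) : AdeleRing (𝓞 K) K) := by
    intro j
    rw [Units.val_mul, coe_posRealDiagonal, Matrix.mul_diagonal]
  -- `ω` is upper triangular
  have hω0 : ∀ j, j < i → (ω : Matrix (Fin n) (Fin n) (AdeleRing (𝓞 K) K)) i j = 0 :=
    fun j hji => (mem_standardParabolicGL_iff _ _).1 (hΩB hω) hji
  -- finite local heights of the row
  have hfin : ∀ v, vecFinHeight K v (((ω * posRealDiagonal n K a : GL (Fin n) (AdeleRing (𝓞 K) K)) :
      Matrix (Fin n) (Fin n) (AdeleRing (𝓞 K) K)) i) ≤ GLn.localHeight n K v ω := by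
    intro v
    refine vecFinHeight_le fun j => ?_
    rw [hMij, AdeleRing.mul_snd_apply, posRealIdele_snd_apply, mul_one]
    exact nnnorm_snd_apply_le_localHeight ω i j v
  -- Euclidean norms of the row
  have harch : ∀ w, vecArchNorm K w (((ω * posRealDiagonal n K a : GL (Fin n) (AdeleRing (𝓞 K) K)) :
      Matrix (Fin n) (Fin n) (AdeleRing (𝓞 K) K)) i) ≤ NNReal.sqrt n * B₁ * A := by
    intro w
    rw [vecArchNorm]
    have hle : ∀ j, ‖((((ω * posRealDiagonal n K a : GL (Fin n) (AdeleRing (𝓞 K) K)) :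
        Matrix (Fin n) (Fin n) (AdeleRing (𝓞 K) K)) i j).1) w‖₊ ^ 2 ≤ (B₁ * A) ^ 2 := by
      intro j
      refine pow_le_pow_left' ?_ 2
      rw [hMij, AdeleRing.mul_fst_apply, nnnorm_mul, nnnorm_posRealIdele_fst_apply]
      by_cases hji : j < i
      · rw [hω0 j hji, AdeleRing.zero_fst_apply, nnnorm_zero, zero_mul]
        exact bot_le
      · exact mul_le_mul' ((nnnorm_fst_apply_le_archHeight ω i j w).trans hB₁ω)
          (hA j (not_lt.1 hji))
    calc NNReal.sqrt (∑ j, ‖((((ω * posRealDiagonal n K a : GL (Fin n) (AdeleRing (𝓞 K) K)) :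
            Matrix (Fin n) (Fin n) (AdeleRing (𝓞 K) K)) i j).1) w‖₊ ^ 2)
        ≤ NNReal.sqrt (∑ _j : Fin n, (B₁ * A) ^ 2) :=
          NNReal.sqrt_le_sqrt.2 (Finset.sum_le_sum fun j _ => hle j)
      _ = NNReal.sqrt n * B₁ * A := by
          rw [Finset.sum_const, Finset.card_univ, Fintype.card_fin, nsmul_eq_mul, NNReal.sqrt_mul,
            NNReal.sqrt_sq, mul_assoc]
  -- assemble
  rw [vecHeight]
  calc (∏ w : InfinitePlace K, vecArchNorm K w (((ω * posRealDiagonal n K a :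
          GL (Fin n) (AdeleRing (𝓞 K) K)) : Matrix (Fin n) (Fin n) (AdeleRing (𝓞 K) K)) i) ^ w.mult) *
        ∏ᶠ v, vecFinHeight K v (((ω * posRealDiagonal n K a : GL (Fin n) (AdeleRing (𝓞 K) K)) :
          Matrix (Fin n) (Fin n) (AdeleRing (𝓞 K) K)) i)
      ≤ (∏ w : InfinitePlace K, (NNReal.sqrt n * B₁ * A) ^ w.mult) *
          ∏ᶠ v, GLn.localHeight n K v ω := by
        refine mul_le_mul' (Finset.prod_le_prod' fun w _ => pow_le_pow_left' (harch w) _) ?_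
        by_cases hf : (fun v => vecFinHeight K v (((ω * posRealDiagonal n K a :
            GL (Fin n) (AdeleRing (𝓞 K) K)) : Matrix (Fin n) (Fin n) (AdeleRing (𝓞 K) K)) i)).HasFiniteMulSupport
        · exact finprod_le_finprod' hf (GLn.mulSupport_localHeight_finite_holds ω) fun v => hfin v
        · rw [finprod_of_not_hasFiniteMulSupport hf]
          exact one_le_finprod' fun v => GLn.one_le_localHeight v ω
    _ = (NNReal.sqrt n * B₁) ^ Module.finrank ℚ K * (∏ᶠ v, GLn.localHeight n K v ω) *
          A ^ Module.finrank ℚ K := by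
        rw [Finset.prod_pow_eq_pow_sum, InfinitePlace.sum_mult_eq, mul_pow]; ring
    _ ≤ (NNReal.sqrt n * B₁) ^ Module.finrank ℚ K * B₂.toNNReal * A ^ Module.finrank ℚ K :=
        mul_le_mul' (mul_le_mul' le_rfl hB₂ω) le_rfl

/-! ### The registered statement -/

/-- **The two height lemmas of the decay road** (registered stub `stub_decay_height_lemmas`):
(a) an adelic vector with finite height data and a non-zero principal coordinate has height
`≥ 1` (`one_le_vecHeight_of_apply_eq_algebraMap`); (b) the rows of `ω · diag(z(a)) · k`, `ω` in a
compact part of the Borel, `k` in the maximal compact subgroup, have height `≪ A^{[K:ℚ]}` when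
the relevant `a_j` are `≤ A` (`exists_vecHeight_row_le`). Garrett (2018), §2.2.
[cite: Garrett2018, §2.2 (PDF pp. 81–84)] -/
theorem stub_decay_height_lemmas :
    ∀ {K : Type} [Field K] [NumberField K],
      (∀ {n : ℕ} (x : Fin n → AdeleRing (𝓞 K) K) (j₀ : Fin n) (c : K), c ≠ 0 →
          x j₀ = algebraMap K (AdeleRing (𝓞 K) K) c → IsHeightFinite K x → 1 ≤ vecHeight K x) ∧
      (∀ {n : ℕ} {Ω : Set (GL (Fin n) (AdeleRing (𝓞 K) K))}, IsCompact Ω →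
          Ω ⊆ (standardParabolicGL (AdeleRing (𝓞 K) K) (id : Fin n → Fin n) :
            Set (GL (Fin n) (AdeleRing (𝓞 K) K))) →
          ∃ C : ℝ≥0, ∀ ω ∈ Ω, ∀ (a : Fin n → ℝ≥0ˣ), ∀ k ∈ standardMaximalCompactGL n K,
            ∀ (i : Fin n) (A : ℝ≥0), (∀ j : Fin n, i ≤ j → (a j : ℝ≥0) ≤ A) →
              vecHeight K (((ω * posRealDiagonal n K a * k : GL (Fin n) (AdeleRing (𝓞 K) K)) :
                Matrix (Fin n) (Fin n) (AdeleRing (𝓞 K) K)) i) ≤ C * A ^ Module.finrank ℚ K) := by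
  intro K _ _
  exact ⟨fun x j₀ c hc hx hfin => one_le_vecHeight_of_apply_eq_algebraMap x j₀ hc hx hfin,
    fun hΩ hΩB => exists_vecHeight_row_le hΩ hΩB⟩

end Summit.Langlands.Langlands.Theorems.GapDecayHeights

end
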